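import Literature.Analysis.FluidPDE.CurlFreeLiouville
import Literature.Analysis.FluidPDE.WeaklyHarmonicInteriorBound
import HarnessLib

/-!
# Local harmonic tools for the exterior region of an extinct Type-I apex
# (item `TerminalTrace.TypeITraceScarL3`, stmt-NavierStokesRegularity-18385, seed s25-6 «the vorticity cut»)

Seat ns-typeII-p3 g9 (cell ns-regularity-ideate), `--supports stmt-NavierStokesRegularity-18385` (helper).
Two LOCAL versions of tree facts, needed because the irrotational representative of a spread apex
lives only on an exterior region `(closedBall 0 R)ᶜ`, not on all of `ℝ³`:

* `laplacian_eq_zero_of_eventually_curl_eq_zero_of_divergence_eq_zero` — the pointwise form of the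
  tree's `laplacian_eq_zero_of_curl_eq_zero_of_isDivFree` (KNSS 2009 Lemma 3.1: `curl V = 0`,
  `div V = 0` ⇒ `ΔV = 0`): it suffices that `V` is `C²` at `x` and that `curl V`, `div V` vanish
  NEAR `x` (coordinates: `ΔVᵢ = Σⱼ ∂ⱼ∂ⱼVᵢ = Σⱼ ∂ⱼ∂ᵢVⱼ = ∂ᵢ div V = 0`, all derivatives taken at `x`).
* `exists_const_abs_le_integral_ball_of_harmonicOn` — the interior `L^∞–L¹` mean value bound for a
  function `C²` and harmonic on an open ball, `|h(x)| ≤ C r⁻³ ∫_{B(x,r)} |h|` with a universal `C`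
  (the tree's `abs_le_of_laplacian_eq_zero_ball`, Gilbarg–Trudinger Thm 2.1, applied to a bump
  cut-off `χ h`, `χ ≡ 1` on `B(x, r/3)`, supported in `B(x, r/2)`).

WHAT THIS IS NOT: not NS-specific; calculus lemmas for the C2 half («exterior-irrotational ⇒
confined») of the vorticity cut of Stub C.  [folklore; GilbargTrudinger2001 Thm 2.1; KNSS2009 Lemma 3.1]
-/

noncomputable section

set_option linter.dupNamespace false

namespace Summit.NavierStokesRegularity.NavierStokesRegularity.Theorems.TypeITraceScarL3

open MeasureTheory Set Function Filter Topology Metric InnerProductSpace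
open Literature.Analysis.FluidPDE
open scoped NNReal ENNReal RealInnerProductSpace Laplacian ContDiff

/-! ### `curl V = 0`, `div V = 0` near `x` ⇒ `ΔV(x) = 0` -/

/-- Coordinates of the second derivative, pointwise version of the tree's `fderiv_fderiv_apply_coord`:
`∂ₖ (y ↦ (DV(y) h)ᵢ)(x) = (D²V(x) k h)ᵢ` as soon as `DV` is differentiable at `x`. [folklore] -/
theorem fderiv_fderiv_apply_coord_of_differentiableAt
    {V : EuclideanSpace ℝ (Fin 3) → EuclideanSpace ℝ (Fin 3)} {x : EuclideanSpace ℝ (Fin 3)}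
    (hd : DifferentiableAt ℝ (fderiv ℝ V) x) (h k : EuclideanSpace ℝ (Fin 3)) (i : Fin 3) :
    fderiv ℝ (fun y => fderiv ℝ V y h i) x k = fderiv ℝ (fderiv ℝ V) x k h i := by
  have hdh : DifferentiableAt ℝ (fun y => fderiv ℝ V y h) x := hd.clm_apply (differentiableAt_const h)
  have e1 : (fun y => fderiv ℝ V y h i) =
      (EuclideanSpace.proj i : EuclideanSpace ℝ (Fin 3) →L[ℝ] ℝ) ∘ fun y => fderiv ℝ V y h := by
    funext y; rfl
  rw [e1, fderiv_comp x (EuclideanSpace.proj i : EuclideanSpace ℝ (Fin 3) →L[ℝ] ℝ).differentiableAt hdh,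
    ContinuousLinearMap.fderiv, ContinuousLinearMap.comp_apply,
    fderiv_clm_apply hd (differentiableAt_const h)]
  simp

/-- **An irrotational incompressible field is harmonic — pointwise form.**  If `V : ℝ³ → ℝ³` is `C²`
at `x` and `curl V = 0`, `div V = 0` in a neighbourhood of `x`, then `ΔV(x) = 0`
(`ΔVᵢ = Σⱼ ∂ⱼ∂ⱼVᵢ = Σⱼ ∂ⱼ∂ᵢVⱼ = ∂ᵢ div V = 0`, the symmetry `∂ⱼVᵢ = ∂ᵢVⱼ` holding near `x` and being
differentiated at `x`; KNSS 2009 "the Liouville theorem for the system `curl u = 0`, `div u = 0`").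
[cite: KochNadirashviliSereginSverak2009, Lemma 3.1 (arXiv p. 7)] -/
theorem laplacian_eq_zero_of_eventually_curl_eq_zero_of_divergence_eq_zero
    {V : EuclideanSpace ℝ (Fin 3) → EuclideanSpace ℝ (Fin 3)} {x : EuclideanSpace ℝ (Fin 3)}
    (hV : ContDiffAt ℝ 2 V x) (hcurl : ∀ᶠ y in 𝓝 x, curl V y = 0)
    (hdiv : ∀ᶠ y in 𝓝 x, VectorCalculus.divergence V y = 0) :
    (Δ V) x = 0 := by
  set T : EuclideanSpace ℝ (Fin 3) →L[ℝ] EuclideanSpace ℝ (Fin 3) →L[ℝ] EuclideanSpace ℝ (Fin 3) :=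
    fderiv ℝ (fderiv ℝ V) x with hT
  have hd : DifferentiableAt ℝ (fderiv ℝ V) x :=
    (hV.fderiv_right (m := 1) le_rfl).differentiableAt one_ne_zero
  -- (1) symmetry of the Jacobian near `x`
  have hsym : ∀ i j : Fin 3,
      (fun y => fderiv ℝ V y (EuclideanSpace.single j (1 : ℝ)) i) =ᶠ[𝓝 x]
        fun y => fderiv ℝ V y (EuclideanSpace.single i (1 : ℝ)) j := fun i j =>
    hcurl.mono fun y hy =>
      apply_single_comm_of_curlCLM_eq_zero (by rw [← curl_eq_curlCLM]; exact hy) i j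
  -- (2) hence symmetry of the second derivative at `x` in the value/direction indices
  have hT1 : ∀ i j k : Fin 3,
      T (EuclideanSpace.single k (1 : ℝ)) (EuclideanSpace.single j (1 : ℝ)) i =
        T (EuclideanSpace.single k (1 : ℝ)) (EuclideanSpace.single i (1 : ℝ)) j := by
    intro i j k
    rw [hT, ← fderiv_fderiv_apply_coord_of_differentiableAt hd (EuclideanSpace.single j (1 : ℝ))
        (EuclideanSpace.single k (1 : ℝ)) i,
      ← fderiv_fderiv_apply_coord_of_differentiableAt hd (EuclideanSpace.single i (1 : ℝ))
        (EuclideanSpace.single k (1 : ℝ)) j, (hsym i j).fderiv_eq]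
  -- (3) symmetry of the second derivative in its two directions
  have hT2 : ∀ h k : EuclideanSpace ℝ (Fin 3), T h k = T k h := fun h k =>
    (hV.isSymmSndFDerivAt (by simp)) h k
  -- (4) the derivative of the divergence vanishes at `x`
  have hdiv' : ∀ k : EuclideanSpace ℝ (Fin 3),
      ∑ j, T k (EuclideanSpace.single j (1 : ℝ)) j = 0 := by
    intro k
    have hzero : (fun y => ∑ j, fderiv ℝ V y (EuclideanSpace.single j (1 : ℝ)) j) =ᶠ[𝓝 x]
        fun _ => (0 : ℝ) :=
      hdiv.mono fun y hy => by
        have h := hy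
        rw [VectorCalculus.divergence, trace_eq_sum_coord] at h
        exact h
    have hdj : ∀ j : Fin 3,
        DifferentiableAt ℝ (fun y => fderiv ℝ V y (EuclideanSpace.single j (1 : ℝ)) j) x := by
      intro j
      have hdh : DifferentiableAt ℝ (fun y => fderiv ℝ V y (EuclideanSpace.single j (1 : ℝ))) x :=
        hd.clm_apply (differentiableAt_const _)
      have e1 : (fun y => fderiv ℝ V y (EuclideanSpace.single j (1 : ℝ)) j) =
          (EuclideanSpace.proj j : EuclideanSpace ℝ (Fin 3) →L[ℝ] ℝ) ∘
            fun y => fderiv ℝ V y (EuclideanSpace.single j (1 : ℝ)) := by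
        funext y; rfl
      rw [e1]
      exact (EuclideanSpace.proj j : EuclideanSpace ℝ (Fin 3) →L[ℝ] ℝ).differentiableAt.comp x hdh
    have h1 : fderiv ℝ (fun y => ∑ j, fderiv ℝ V y (EuclideanSpace.single j (1 : ℝ)) j) x k =
        ∑ j, T k (EuclideanSpace.single j (1 : ℝ)) j := by
      rw [fderiv_fun_sum fun j _ => hdj j, _root_.sum_apply]
      exact Finset.sum_congr rfl fun j _ => fderiv_fderiv_apply_coord_of_differentiableAt hd _ _ j
    rw [← h1, hzero.fderiv_eq]
    simp
  -- (5) assemble, coordinate by coordinate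
  have hΔ : (Δ V) x =
      ∑ j, T (EuclideanSpace.single j (1 : ℝ)) (EuclideanSpace.single j (1 : ℝ)) := by
    rw [congrFun (InnerProductSpace.laplacian_eq_iteratedFDeriv_orthonormalBasis V
      (EuclideanSpace.basisFun (Fin 3) ℝ)) x]
    refine Finset.sum_congr rfl fun j _ => ?_
    rw [iteratedFDeriv_two_apply]
    simp [hT]
  ext i
  rw [hΔ]
  simp only [PiLp.zero_apply]
  rw [show (∑ j, T (EuclideanSpace.single j (1 : ℝ)) (EuclideanSpace.single j (1 : ℝ))) i =
      ∑ j, T (EuclideanSpace.single j (1 : ℝ)) (EuclideanSpace.single j (1 : ℝ)) i from by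
    simp [Finset.sum_apply]]
  calc ∑ j, T (EuclideanSpace.single j (1 : ℝ)) (EuclideanSpace.single j (1 : ℝ)) i
      = ∑ j, T (EuclideanSpace.single j (1 : ℝ)) (EuclideanSpace.single i (1 : ℝ)) j :=
        Finset.sum_congr rfl fun j _ => hT1 i j j
    _ = ∑ j, T (EuclideanSpace.single i (1 : ℝ)) (EuclideanSpace.single j (1 : ℝ)) j :=
        Finset.sum_congr rfl fun j _ => by rw [hT2]
    _ = 0 := hdiv' (EuclideanSpace.single i (1 : ℝ))

/-! ### Interior mean value bound on a ball, for locally `C²` harmonic functions -/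

/-- **Interior `L^∞–L¹` bound for a function harmonic on a ball.**  There is a universal constant
`C ≥ 0` such that for every `h : ℝ³ → ℝ` which is `C²` and harmonic on the open ball `B(x, r)` and
integrable there, `|h(x)| ≤ C r⁻³ ∫_{B(x,r)} |h|`.  Proof: cut off with a smooth bump `χ`, `χ ≡ 1`
on `B(x, r/3)` and supported in `B(x, r/2)`; `χ h ∈ C²(ℝ³)` is integrable and harmonic on
`B(x, r/4)`, so the tree's `abs_le_of_laplacian_eq_zero_ball` (mean value with the weight
`λ^{r/8, r/4}`) applies, and `∫ |χ h| ≤ ∫_{B(x,r)} |h|`. [cite: GilbargTrudinger2001, Thm 2.1] -/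
theorem exists_const_abs_le_integral_ball_of_harmonicOn :
    ∃ C : ℝ, 0 ≤ C ∧ ∀ (h : EuclideanSpace ℝ (Fin 3) → ℝ) (x : EuclideanSpace ℝ (Fin 3)) (r : ℝ),
      0 < r → ContDiffOn ℝ 2 h (ball x r) → (∀ w ∈ ball x r, (Δ h) w = 0) →
      IntegrableOn h (ball x r) volume →
      |h x| ≤ C * (r ^ 3)⁻¹ * ∫ y in ball x r, |h y| := by
  obtain ⟨M, hM0, hM⟩ := exists_bound_newtonFarLaplacian_one_two
  refine ⟨8 ^ 3 * M, by positivity, fun h x r hr hh hΔ hint => ?_⟩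
  -- the cut-off
  let χ : ContDiffBump x := ⟨r / 3, r / 2, by positivity, by linarith⟩
  have hχin : χ.rIn = r / 3 := rfl
  have hχout : χ.rOut = r / 2 := rfl
  set f : EuclideanSpace ℝ (Fin 3) → ℝ := fun y => χ y * h y with hfdef
  -- `f` is `C²`
  have hf2 : ContDiff ℝ 2 f := by
    refine contDiff_iff_contDiffAt.2 fun y => ?_
    by_cases hy : y ∈ ball x r
    · exact ((χ.contDiff (n := 2)).contDiffAt).mul (hh.contDiffAt (isOpen_ball.mem_nhds hy))
    · -- `f = 0` near `y`
      have hdist : r / 2 < dist y x := by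
        rw [mem_ball, not_lt] at hy; linarith
      have hopen : IsOpen {y' : EuclideanSpace ℝ (Fin 3) | r / 2 < dist y' x} :=
        isOpen_lt continuous_const (continuous_id.dist continuous_const)
      have hev : f =ᶠ[𝓝 y] fun _ => (0 : ℝ) := by
        filter_upwards [hopen.mem_nhds hdist] with y' hy'
        have hχ0 : χ y' = 0 := χ.zero_of_le_dist (by rw [hχout]; exact le_of_lt hy')
        simp only [hfdef, hχ0, zero_mul]
      exact (contDiffAt_const (c := (0 : ℝ))).congr_of_eventuallyEq hev
  -- `f` has compact support and is integrable
  have hfc : HasCompactSupport f := by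
    have : HasCompactSupport ((χ : EuclideanSpace ℝ (Fin 3) → ℝ) * h) := χ.hasCompactSupport.mul_right
    simpa [hfdef, Pi.mul_def] using this
  have hfi : Integrable f volume := hf2.continuous.integrable_of_hasCompactSupport hfc
  -- `f` is harmonic on `B(x, r/4)` (it agrees with `h` on `B(x, r/3)`)
  have hΔf : ∀ w ∈ ball x (r / 4), (Δ f) w = 0 := by
    intro w hw
    have hw3 : w ∈ ball x (r / 3) := ball_subset_ball (by linarith) hw
    have hev : f =ᶠ[𝓝 w] h := by
      filter_upwards [isOpen_ball.mem_nhds hw3] with y' hy'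
      have hχ1 : χ y' = 1 := χ.one_of_mem_closedBall (by rw [hχin]; exact ball_subset_closedBall hy')
      simp only [hfdef, hχ1, one_mul]
    rw [(laplacian_congr_nhds hev).self_of_nhds]
    exact hΔ w (ball_subset_ball (by linarith) hw)
  -- the tree's mean value bound for `f`
  have hmv := abs_le_of_laplacian_eq_zero_ball hf2 hfi hr hΔf hM
  -- `f x = h x`
  have hfx : f x = h x := by
    have hχ1 : χ x = 1 := χ.one_of_mem_closedBall (mem_closedBall_self (by positivity))
    simp only [hfdef, hχ1, one_mul]
  -- `∫ |f| ≤ ∫_{B(x,r)} |h|`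
  have hle : ∫ y, |f y| ≤ ∫ y in ball x r, |h y| := by
    have h1 : ∫ y, |f y| = ∫ y in ball x r, |f y| := by
      refine (setIntegral_eq_integral_of_forall_compl_eq_zero fun y hy => ?_).symm
      have hdist : r / 2 ≤ dist y x := by
        rw [mem_ball, not_lt] at hy; linarith
      have hχ0 : χ y = 0 := χ.zero_of_le_dist (by rw [hχout]; exact hdist)
      simp only [hfdef, hχ0, zero_mul, abs_zero]
    rw [h1]
    refine setIntegral_mono hfi.abs.integrableOn hint.abs fun y => ?_
    show |f y| ≤ |h y|
    rw [hfdef]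
    show |χ y * h y| ≤ |h y|
    rw [abs_mul, abs_of_nonneg χ.nonneg]
    exact mul_le_of_le_one_left (abs_nonneg _) χ.le_one
  calc |h x| = |f x| := by rw [hfx]
    _ ≤ 8 ^ 3 * M * (r ^ 3)⁻¹ * ∫ y, |f y| := hmv
    _ ≤ 8 ^ 3 * M * (r ^ 3)⁻¹ * ∫ y in ball x r, |h y| :=
        mul_le_mul_of_nonneg_left hle (by positivity)

end Summit.NavierStokesRegularity.NavierStokesRegularity.Theorems.TypeITraceScarL3

end
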